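import Summits.Ventures.Crystal3D.Theorems.StickyWulffConstantTextureBuildCellsLabels
import HarnessLib

/-!
# TB-D assembly, part 19a: THE TENT ZONES and the identification «pieces ∩ zone = tent solid ∩ zone a.e.»
# (lane T, crux `TextureLiminfV5`, stmt-Ventures-23912; blueprint HOME/wulff-p2/g20/TexShadowTB.lean; split from part 19 so that it does not wait on …TentPerimeter)

HONEST FRAMING. Venture `Summits/Ventures/Crystal3D` (cell `crystal3d-full`), route `route-Ventures-StickyWulffConstant`, helper `--supports` the
law-v5 crux `TextureLiminfV5` (stmt-Ventures-23912).  Census-free bookkeeping (standard axioms); F-C1 not moved.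

* `TexInput.zone` (the open tent zone `U_f ∩ laySlab_f i` of class `c = (f, i)`), `isOpen_zone`;
* `TexInput.mem_pieces_of_mem_cell` — a point of the tent solid in the zone that lies in some cell lies in a PIECE (the cell is labelled with that class);
* `TexInput.pieces_inter_zone_subset` / `G_inter_zone_ae_subset` / `pieces_inter_zone_ae_eq` — inside the zone the pieces ARE the tent solid a.e.
-/

noncomputable section

open scoped BigOperators InnerProductSpace ENNReal

namespace Summit.Ventures.Crystal3D.Cruxes.TextureLiminf.TexShadow

open Summit.Ventures.Crystal3D Summit.Ventures.Crystal3D.Theorems MeasureTheory Set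
open Summit.Ventures.Crystal3D.TentCertificate (isOpen_laySlab mem_laySlab_iff)

namespace TexInput

variable {C R₀ : ℝ} {N : ℕ} {x : Fin N → E3} {rc : RiseredCover C R₀ N x} {δ : ℝ} {μ : Mesh₅ rc δ} (I : TexInput rc μ)

/-- the tent zone of class `c = (f, i)`: `U_f ∩ laySlab_f i` -/
def zone (c : Fin I.cells.n) : Set E3 :=
  (rc.tent (I.enc.symm c).1).U ∩ laySlab (rc.tent (I.enc.symm c).1).L (rc.tent (I.enc.symm c).1).s (I.enc.symm c).2.1

/-- Tent zones are open. -/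
theorem isOpen_zone (c : Fin I.cells.n) : IsOpen (I.zone c) := (rc.tent _).hU.inter (isOpen_laySlab _ _ _)

/-- The pieces are the cells of the labelled indices (definitional bookkeeping). -/
theorem polytope_Hp_eq (i : Fin I.cells.M) : polytope (I.cells.Hp i) = polytope (signedH I.𝓗 (I.cells.T (I.cells.idx i))) := rfl

/-- The label of a cell is `lab₀` of its positive part. -/
theorem cells_lab (j : Fin I.cells.k) : I.cells.lab j = I.lab₀ (I.cells.T j) := rfl

/-- **Pieces inside a tent zone lie in the tent solid.** -/
theorem pieces_inter_zone_subset (c : Fin I.cells.n) :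
    (⋃ i, polytope (I.cells.Hp i)) ∩ I.zone c ⊆ (I.ct (I.enc.symm c).1).G ∩ I.zone c := by
  rintro z ⟨hz, hzone⟩
  obtain ⟨i, hzi⟩ := mem_iUnion.1 hz
  refine ⟨?_, hzone⟩
  have hlab : (I.lab₀ (I.cells.T (I.cells.idx i))).isSome = true := I.cells.isSome_lab_idx i
  exact I.subset_G_of_labelled_meets_U hlab hzi hzone.1 hzi

/-- The tent solid lies in the union of the bounded family. -/
theorem G_subset_iUnion_𝒢 (f : Fin rc.ng) : (I.ct f).G ⊆ ⋃ G ∈ I.𝒢, polytope G := by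
  intro z hz
  rw [(I.ct f).hG, mem_iUnion] at hz
  obtain ⟨j, hj⟩ := hz
  refine mem_iUnion₂.2 ⟨(I.ct f).H j, ?_, hj⟩
  simp only [𝒢, Finset.mem_union, Finset.mem_biUnion, Finset.mem_univ, true_and, Finset.mem_image]
  exact Or.inr ⟨f, j, rfl⟩

/-- **A point of the tent solid in the tent zone that lies in SOME cell lies in a PIECE** (that cell is labelled with this class). -/
theorem mem_pieces_of_mem_cell {c : Fin I.cells.n} {z : E3} (hzG : z ∈ (I.ct (I.enc.symm c).1).G) (hzone : z ∈ I.zone c)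
    {j : Fin I.cells.k} (hzj : z ∈ I.cells.cell j) : z ∈ ⋃ i, polytope (I.cells.Hp i) := by
  set f := (I.enc.symm c).1 with hf
  set ii := (I.enc.symm c).2 with hii
  have hne : (polytope (signedH I.𝓗 (I.cells.T j))).Nonempty := ⟨z, hzj⟩
  -- the cell lies in a certificate piece of `f`, in `f`'s territory, in no core, and in the own slab `ii`
  have hzU : z ∈ (rc.tent f).U := hzone.1
  have hzD : z ∈ ⋃ j', polytope (μ.HD f j') := by have := hzU; rw [μ.hU f] at this; exact this.1
  obtain ⟨j', hzj'⟩ := mem_iUnion.1 hzD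
  have hterr : ∃ j', μ.HD f j' ⊆ I.cells.T j :=
    ⟨j', subset_T_of_cell_subset (I.HD_subset_𝓗 f j') hne (refineCells_subset_of_mem _ _ _ _ _ _ _ j (I.HD_subset_𝓗 f j') hzj hzj')⟩
  have hzG' := hzG
  rw [(I.ct f).hG, mem_iUnion] at hzG'
  obtain ⟨jc, hzjc⟩ := hzG'
  have htent : ∃ jc, (I.ct f).H jc ⊆ I.cells.T j :=
    ⟨jc, subset_T_of_cell_subset (I.certH_subset_𝓗 f jc) hne (refineCells_subset_of_mem _ _ _ _ _ _ _ j (I.certH_subset_𝓗 f jc) hzj hzjc)⟩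
  have hcore : ¬ ∃ f' : Fin rc.ng, ∃ jj, μ.HC f' jj ⊆ I.cells.T j := by
    rintro ⟨f', jj, hjj⟩
    have hsub : polytope (signedH I.𝓗 (I.cells.T j)) ⊆ polytope (μ.HC f' jj) := cell_subset_of_subset_T (I.HC_subset_𝓗 f' jj) hjj
    have hf' : f' = f := grain_eq_of_subset_D_of_meets (hsub.trans (μ.hCD f' jj)) hzj hzD
    subst hf'
    exact Set.disjoint_left.1 (disjoint_U_of_subset_HC hsub) hzj hzU
  have hslabz : z ∈ polytope (laySlabH (rc.tent f).L (rc.tent f).s ii.1) := by rw [← laySlab_eq_polytope]; exact hzone.2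
  have hslab : laySlabH (rc.tent f).L (rc.tent f).s ii.1 ⊆ I.cells.T j :=
    subset_T_of_cell_subset (I.laySlabH_subset_𝓗 f ii.2) hne (refineCells_subset_of_mem _ _ _ _ _ _ _ j (I.laySlabH_subset_𝓗 f ii.2) hzj hslabz)
  have hlab : I.lab₀ (I.cells.T j) = some (I.enc ⟨f, ⟨ii.1, ii.2⟩⟩) := I.lab₀_eq_of_tent hne hcore htent hterr ii.2 hslab
  have hsome : (I.cells.lab j).isSome = true := by rw [cells_lab, hlab]; rfl
  obtain ⟨i, hi⟩ := I.cells.exists_idx_eq hsome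
  refine mem_iUnion.2 ⟨i, ?_⟩
  rw [polytope_Hp_eq, hi]
  exact hzj

/-- **The tent solid in the tent zone lies a.e. in the pieces.** -/
theorem G_inter_zone_ae_subset (c : Fin I.cells.n) :
    volume (((I.ct (I.enc.symm c).1).G ∩ I.zone c) \ ((⋃ i, polytope (I.cells.Hp i)) ∩ I.zone c)) = 0 := by
  have hcover := refineCells_ae_cover I.𝓗 I.𝓗_unit I.𝒢 I.𝒢_subset_𝓗 I.𝒢_bounded I.n I.lab₀
  have hnull : volume ((⋃ G ∈ I.𝒢, polytope G) \ ⋃ j, I.cells.cell j) = 0 := (ae_eq_set.1 hcover).1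
  refine measure_mono_null (fun z hz => ?_) hnull
  obtain ⟨⟨hzG, hzone⟩, hnot⟩ := hz
  refine ⟨I.G_subset_iUnion_𝒢 _ hzG, fun hcell => hnot ⟨?_, hzone⟩⟩
  obtain ⟨j, hzj⟩ := mem_iUnion.1 hcell
  exact I.mem_pieces_of_mem_cell hzG hzone hzj

/-- **Inside the tent zone the pieces ARE the tent solid, a.e.** -/
theorem pieces_inter_zone_ae_eq (c : Fin I.cells.n) :
    ((⋃ i, polytope (I.cells.Hp i)) ∩ I.zone c : Set E3) =ᵐ[volume] ((I.ct (I.enc.symm c).1).G ∩ I.zone c : Set E3) := by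
  refine ae_eq_set.2 ⟨?_, I.G_inter_zone_ae_subset c⟩
  exact measure_mono_null (fun z hz => (hz.2 (I.pieces_inter_zone_subset c hz.1)).elim) measure_empty

end TexInput

end Summit.Ventures.Crystal3D.Cruxes.TextureLiminf.TexShadow

end
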